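/-
Copyright (c) 2026. All rights reserved.
Released under Apache 2.0 license as described in the file LICENSE.
Authors: abc-iut cell, seat abc-iut-L4-t9 (gen 3; block W2-B2, model of [AbsTopIII] Cor 3.7).
-/
import Literature.AnabelianGeometry.AbsoluteAnabelian.AbsTopIII.MLFGaloisModelRigidity
import Literature.AnabelianGeometry.AbsoluteAnabelian.GaloisPadicLogPerfection
import HarnessLib

/-!
# [AbsTopIII] Def 3.1 (iv): the arithmetic data `k̄^×`, `(k̄^×)^pf` on `ℚ̄_p`, their Galois actions, and the
# maps `ι_×`, `ι_log` on arithmetic data (with the Lemma-3.4 separation `[p] ∉ ι_log(k̄^×)`)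

S. Mochizuki, *Topics in absolute anabelian geometry III* [MochizukiAbsTopIII2015] (kurims manuscript
`paper:url-5493eb38cbb7`), Def 3.1 (iv) p. 69: "`λ^×`, `λ^{×pf}` [...] (the ind-topological space `k̄^×`
[resp. `(k̄^×)^pf`], with its natural `Π_k`-action) [...] `ι_log : λ^× ∘ log_{TF,TF} → λ^{×pf}` for the
natural transformation induced by the natural inclusion `(k~)^× ↪ k~ = (𝒪^×_k̄)^pf ↪ (k̄^×)^pf` and
`ι_× : λ^× → λ^{×pf}` for the natural transformation induced by the natural map `k̄^× → (k̄^×)^pf`";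
Lemma 3.4 p. 74: "an inclusion `α^pf((𝒪^⊳_k̄)^pf) ⊆ (𝒪^×_k̄)^pf` would imply that `(𝒪^⊳_k̄)^pf ⊆
(𝒪^×_k̄)^pf`, a contradiction".

First half of the construction of the MODEL `BiAnabelianSetting` of Cor 3.7 (abc-iut-L4-t9; continued in
`MLFLogFrobeniusFunctors.lean`): the OBJECT-LEVEL arithmetic data over the fixed closure `ℚ̄_p`,

* `TimesCarrier p` — `k̄^× = ℚ̄_pˣ`; `TimesPfCarrier p` — `(k̄^×)^pf = ℚ̄_pˣ/μ` (the perfection of the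
  divisible group `k̄^×` is its quotient by the torsion `μ`, as in abc-iut-L6-d2's
  `GaloisPadicLogPerfection` for `(𝒪^×_k̄)^pf`); both as bare types with the DISCRETE topology
  (Rmk 3.1.1 p. 70 convention, cf. abc-iut-L4-t2's topology-free `TF/TM` data; the ind-topology of
  print is not modelled), hence objects of `TS`;
* `unitsGal σ`, `unitsPfGal σ` — the actions of `σ ∈ Gal(ℚ̄_p/ℚ_p)`;
* `timesToPf` — `ι_×` on data (the quotient map); `iotaLogMap` — `ι_log` on data IN LOG-COORDINATES:
  `y ↦ [log_k̄⁻¹(y)]` via the REAL logarithm (abc-iut-L3-t11's `GaloisPadicLog.ofPadicAlgCl`,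
  abc-iut-L6-d2's `logEquiv : 𝒪^×_k̄/μ ≃ k̄`), `Gal(ℚ̄_p/ℚ_p)`-equivariant (`iotaLogMap_unitsGal`);
* `iotaLogMap_ne_timesToPf_prime` — the Lemma-3.4 separation used by Cor 3.6 (iv) / 3.7 (iv):
  `ι_log(y) ≠ [p] = ι_×(p)` for every `y` (`ι_log` lands in `(𝒪^×_k̄)^pf`, and `‖p‖ < 1`).

HONEST FRAMING: kernel constructions over refereed pre-IUT definitions (residue characteristic `p`, fixed
closure `ℚ̄_p`); nothing here bears on [IUTchIII] Cor. 3.12.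
-/

set_option autoImplicit false

noncomputable section

namespace Literature.AnabelianGeometry.AbsoluteAnabelian.AbsTopIII

open Literature.NumberTheory.Transcendental

variable (p : ℕ) [hp : Fact p.Prime]

/-! ## The arithmetic data `k̄^×` and `(k̄^×)^pf = k̄^×/μ` as discrete `TS`-objects -/

/-- The arithmetic datum `k̄^× = ℚ̄_p^×` of `λ^×(Π ↷ k̄)`, as a bare type carrying the DISCRETE topology
(Rmk 3.1.1 convention; a type synonym of `ℚ̄_pˣ`, so that no topology of `ℚ̄_p` is inherited).
[cite: MochizukiAbsTopIII2015, Definition 3.1 (iv) p.69] -/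
def TimesCarrier : Type := (PadicAlgCl p)ˣ

/-- The group structure of `k̄^×`. [cite: MochizukiAbsTopIII2015, Definition 3.1 (iv) p.69] -/
instance : CommGroup (TimesCarrier p) := inferInstanceAs (CommGroup (PadicAlgCl p)ˣ)

/-- The discrete topology on `k̄^×`. [cite: MochizukiAbsTopIII2015, Remark 3.1.1 p.70] -/
instance : TopologicalSpace (TimesCarrier p) := ⊥

/-- `k̄^×` is discrete. [cite: MochizukiAbsTopIII2015, Remark 3.1.1 p.70] -/
instance : DiscreteTopology (TimesCarrier p) := ⟨rfl⟩

/-- A discrete space is locally compact (so `k̄^×` is an object of `TS`).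
[cite: MochizukiAbsTopIII2015, Definition 3.1 (i) p.66] -/
instance : LocallyCompactSpace (TimesCarrier p) :=
  ⟨fun x _ hn => ⟨{x}, by rw [nhds_discrete]; exact Filter.mem_pure.2 rfl,
    Set.singleton_subset_iff.2 (mem_of_mem_nhds hn), isCompact_singleton⟩⟩

variable {p} in
/-- An element of `k̄^×` as a unit of `ℚ̄_p`. [cite: MochizukiAbsTopIII2015, Definition 3.1 (iv) p.69] -/
def TimesCarrier.toUnits (u : TimesCarrier p) : (PadicAlgCl p)ˣ := u

variable {p} in
/-- A unit of `ℚ̄_p` as an element of `k̄^×`. [cite: MochizukiAbsTopIII2015, Definition 3.1 (iv) p.69] -/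
def TimesCarrier.ofUnits (u : (PadicAlgCl p)ˣ) : TimesCarrier p := u

variable {p} in
/-- `toUnits ∘ ofUnits = id`. [cite: MochizukiAbsTopIII2015, Definition 3.1 (iv) p.69] -/
@[simp] theorem TimesCarrier.toUnits_ofUnits (u : (PadicAlgCl p)ˣ) : (TimesCarrier.ofUnits u).toUnits = u :=
  rfl

variable {p} in
/-- Elements of `k̄^×` are determined by their values in `ℚ̄_p`. [cite: MochizukiAbsTopIII2015, Definition 3.1 (iv) p.69] -/
theorem TimesCarrier.ext {u v : TimesCarrier p} (h : (u.toUnits : PadicAlgCl p) = v.toUnits) : u = v :=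
  Units.ext h

/-- The torsion subgroup `μ = μ(k̄)` of `k̄^×` (roots of unity).
[cite: MochizukiAbsTopIII2015, Definition 3.1 (i) p.66] -/
abbrev rootsOfUnityTorsion : Subgroup (TimesCarrier p) := CommGroup.torsion (TimesCarrier p)

/-- The arithmetic datum `(k̄^×)^pf = ℚ̄_p^×/μ` of `λ^{×pf}(Π ↷ k̄)` (perfection of the divisible group
`k̄^×` = quotient by its torsion), as a bare type carrying the DISCRETE topology.
[cite: MochizukiAbsTopIII2015, Definition 3.1 (iv) p.69] -/
def TimesPfCarrier : Type := TimesCarrier p ⧸ rootsOfUnityTorsion p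

/-- The group structure of `(k̄^×)^pf`. [cite: MochizukiAbsTopIII2015, Definition 3.1 (iv) p.69] -/
instance : CommGroup (TimesPfCarrier p) :=
  inferInstanceAs (CommGroup (TimesCarrier p ⧸ rootsOfUnityTorsion p))

/-- The discrete topology on `(k̄^×)^pf`. [cite: MochizukiAbsTopIII2015, Remark 3.1.1 p.70] -/
instance : TopologicalSpace (TimesPfCarrier p) := ⊥

/-- `(k̄^×)^pf` is discrete. [cite: MochizukiAbsTopIII2015, Remark 3.1.1 p.70] -/
instance : DiscreteTopology (TimesPfCarrier p) := ⟨rfl⟩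

/-- A discrete space is locally compact (so `(k̄^×)^pf` is an object of `TS`).
[cite: MochizukiAbsTopIII2015, Definition 3.1 (i) p.66] -/
instance : LocallyCompactSpace (TimesPfCarrier p) :=
  ⟨fun x _ hn => ⟨{x}, by rw [nhds_discrete]; exact Filter.mem_pure.2 rfl,
    Set.singleton_subset_iff.2 (mem_of_mem_nhds hn), isCompact_singleton⟩⟩

variable {p}

/-- `ι_× : k̄^× → (k̄^×)^pf`, "the natural map", as a group homomorphism.
[cite: MochizukiAbsTopIII2015, Definition 3.1 (iv) p.69] -/
def timesToPf : TimesCarrier p →* TimesPfCarrier p := QuotientGroup.mk' (rootsOfUnityTorsion p)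

/-- `ι_×` is the quotient map. [cite: MochizukiAbsTopIII2015, Definition 3.1 (iv) p.69] -/
theorem timesToPf_apply (u : TimesCarrier p) :
    timesToPf u = (QuotientGroup.mk u : TimesCarrier p ⧸ rootsOfUnityTorsion p) := rfl

/-- `[u] = [v]` in `(k̄^×)^pf` iff `u / v` is a root of unity. [cite: MochizukiAbsTopIII2015, Definition 3.1 (iv) p.69] -/
theorem timesToPf_eq_iff (u v : TimesCarrier p) :
    timesToPf u = timesToPf v ↔ ∃ n : ℕ, 0 < n ∧ ((u.toUnits : PadicAlgCl p) / v.toUnits) ^ n = 1 := by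
  have h : timesToPf u = timesToPf v ↔ u / v ∈ rootsOfUnityTorsion p := QuotientGroup.eq_iff_div_mem
  rw [h, CommGroup.mem_torsion, isOfFinOrder_iff_pow_eq_one]
  refine exists_congr fun n => and_congr_right fun _ => ?_
  rw [← Units.val_div_eq_div_val, ← Units.val_pow_eq_pow_val, Units.val_eq_one]
  exact Iff.rfl

/-- The action of `σ ∈ Gal(ℚ̄_p/ℚ_p)` on `k̄^×` (restriction of the field automorphism to units).
[cite: MochizukiAbsTopIII2015, Definition 3.1 (iv) p.69] -/
def unitsGal (σ : PadicAlgCl p ≃ₐ[ℚ_[p]] PadicAlgCl p) : TimesCarrier p →* TimesCarrier p :=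
  Units.map (σ : PadicAlgCl p →* PadicAlgCl p)

/-- The value of `σ · u` is `σ(u)`. [cite: MochizukiAbsTopIII2015, Definition 3.1 (iv) p.69] -/
@[simp] theorem coe_unitsGal (σ : PadicAlgCl p ≃ₐ[ℚ_[p]] PadicAlgCl p) (u : TimesCarrier p) :
    ((unitsGal σ u).toUnits : PadicAlgCl p) = σ (u.toUnits : PadicAlgCl p) := rfl

/-- `unitsGal` is multiplicative in `σ`. [cite: MochizukiAbsTopIII2015, Definition 3.1 (iv) p.69] -/
theorem unitsGal_mul (σ τ : PadicAlgCl p ≃ₐ[ℚ_[p]] PadicAlgCl p) (u : TimesCarrier p) :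
    unitsGal (σ * τ) u = unitsGal σ (unitsGal τ u) := TimesCarrier.ext rfl

/-- `unitsGal 1 = id`. [cite: MochizukiAbsTopIII2015, Definition 3.1 (iv) p.69] -/
theorem unitsGal_one (u : TimesCarrier p) : unitsGal (1 : PadicAlgCl p ≃ₐ[ℚ_[p]] PadicAlgCl p) u = u :=
  TimesCarrier.ext rfl

/-- `σ ∈ Gal(ℚ̄_p/ℚ_p)` maps roots of unity to roots of unity: `μ ≤ σ⁻¹(μ)` (so the action descends to
`(k̄^×)^pf`). [cite: MochizukiAbsTopIII2015, Definition 3.1 (iv) p.69] -/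
theorem torsion_le_comap_unitsGal (σ : PadicAlgCl p ≃ₐ[ℚ_[p]] PadicAlgCl p) :
    rootsOfUnityTorsion p ≤ (rootsOfUnityTorsion p).comap (unitsGal σ) := fun u hu => by
  rw [Subgroup.mem_comap, CommGroup.mem_torsion]
  exact (unitsGal σ).isOfFinOrder ((CommGroup.mem_torsion _).mp hu)

/-- The action of `σ ∈ Gal(ℚ̄_p/ℚ_p)` on `(k̄^×)^pf = k̄^×/μ`. [cite: MochizukiAbsTopIII2015, Definition 3.1 (iv) p.69] -/
def unitsPfGal (σ : PadicAlgCl p ≃ₐ[ℚ_[p]] PadicAlgCl p) : TimesPfCarrier p →* TimesPfCarrier p :=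
  QuotientGroup.map _ _ (unitsGal σ) (torsion_le_comap_unitsGal σ)

/-- `unitsPfGal σ [u] = [σ u]`. [cite: MochizukiAbsTopIII2015, Definition 3.1 (iv) p.69] -/
@[simp] theorem unitsPfGal_mk (σ : PadicAlgCl p ≃ₐ[ℚ_[p]] PadicAlgCl p) (u : TimesCarrier p) :
    unitsPfGal σ (timesToPf u) = timesToPf (unitsGal σ u) := rfl

/-- `unitsPfGal` is multiplicative in `σ`. [cite: MochizukiAbsTopIII2015, Definition 3.1 (iv) p.69] -/
theorem unitsPfGal_mul (σ τ : PadicAlgCl p ≃ₐ[ℚ_[p]] PadicAlgCl p) (x : TimesPfCarrier p) :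
    unitsPfGal (σ * τ) x = unitsPfGal σ (unitsPfGal τ x) := by
  induction x using QuotientGroup.induction_on with
  | H u => exact congrArg timesToPf (unitsGal_mul σ τ u)

/-- `unitsPfGal 1 = id`. [cite: MochizukiAbsTopIII2015, Definition 3.1 (iv) p.69] -/
theorem unitsPfGal_one (x : TimesPfCarrier p) :
    unitsPfGal (1 : PadicAlgCl p ≃ₐ[ℚ_[p]] PadicAlgCl p) x = x := by
  induction x using QuotientGroup.induction_on with
  | H u => exact congrArg timesToPf (unitsGal_one u)

/-! ## `ι_log` on the arithmetic data: `k̄^× = (k~)^× ↪ k~ = (𝒪^×_k̄)^pf ↪ (k̄^×)^pf` in log-coordinates -/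

/-- The real `p`-adic logarithm of `ℚ̄_p` as abc-iut-L4-t2's `GaloisPadicLog` (abc-iut-L3-t11).
[cite: MochizukiAbsTopIII2015, Definition 3.1 (i) p.66] -/
abbrev padicLog (p : ℕ) [Fact p.Prime] : GaloisPadicLog ℚ_[p] (PadicAlgCl p) :=
  GaloisPadicLog.ofPadicAlgCl p

/-- The inclusion `(𝒪^×_k̄)^pf = 𝒪^×_k̄/μ ↪ (k̄^×)^pf = k̄^×/μ` (abc-iut-L6-d2's `unitGroup` realises
`𝒪^×_k̄` inside `k̄^×`). [cite: MochizukiAbsTopIII2015, Definition 3.1 (iv) p.69] -/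
def unitsPfIncl : unitGroup ℚ_[p] (PadicAlgCl p) ⧸ CommGroup.torsion (unitGroup ℚ_[p] (PadicAlgCl p)) →*
    TimesPfCarrier p :=
  QuotientGroup.map _ _ ((unitGroup ℚ_[p] (PadicAlgCl p)).subtype : _ →* TimesCarrier p) fun u hu => by
    rw [Subgroup.mem_comap, CommGroup.mem_torsion]
    exact MonoidHom.isOfFinOrder _ ((CommGroup.mem_torsion _).mp hu)

/-- `unitsPfIncl [u] = [u]`. [cite: MochizukiAbsTopIII2015, Definition 3.1 (iv) p.69] -/
@[simp] theorem unitsPfIncl_mk (u : unitGroup ℚ_[p] (PadicAlgCl p)) :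
    unitsPfIncl (QuotientGroup.mk u) = timesToPf (TimesCarrier.ofUnits (u : (PadicAlgCl p)ˣ)) := rfl

/-- **`ι_log` on arithmetic data, in log-coordinates**: `y ∈ k̄^× = (k~)^×` (the element of `(k~)^×` with
log-coordinate `y`) goes to the class in `(k̄^×)^pf` of `log_k̄⁻¹(y) ∈ (𝒪^×_k̄)^pf` — "the natural inclusion
`(k~)^× ↪ k~ = (𝒪^×_k̄)^pf ↪ (k̄^×)^pf`". A map of SPACES (it intertwines the field structure of `k~` with
the multiplicative structure of `k̄^×`, not the group structures). [cite: MochizukiAbsTopIII2015, Definition 3.1 (iv) p.69] -/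
def iotaLogMap (u : TimesCarrier p) : TimesPfCarrier p :=
  unitsPfIncl ((padicLog p).logEquiv.symm (Multiplicative.ofAdd (u.toUnits : PadicAlgCl p)))

/-- `ι_log` lands in the image of `(𝒪^×_k̄)^pf`: `ι_log(y) = [v]` for a unit `v` of `𝒪_k̄`.
[cite: MochizukiAbsTopIII2015, Definition 3.1 (iv) p.69] -/
theorem iotaLogMap_mem_range (u : TimesCarrier p) :
    ∃ v : (PadicAlgCl p)ˣ, (v : PadicAlgCl p) ∈ unitSubmonoid ℚ_[p] (PadicAlgCl p) ∧
      iotaLogMap u = timesToPf (TimesCarrier.ofUnits v) := by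
  obtain ⟨w, hw⟩ := QuotientGroup.mk_surjective
    ((padicLog p).logEquiv.symm (Multiplicative.ofAdd (u.toUnits : PadicAlgCl p)))
  exact ⟨(w : (PadicAlgCl p)ˣ), w.2, by rw [iotaLogMap, ← hw, unitsPfIncl_mk]⟩

/-- **Equivariance/naturality engine of `ι_log`**: for `σ ∈ Gal(ℚ̄_p/ℚ_p)`,
`ι_log(σ y) = σ · ι_log(y)` — because `log_k̄` is `Gal(ℚ̄_p/ℚ_p)`-equivariant (abc-iut-L6-d2's
`logEquiv_unitsModTorsionGaloisMap`). [cite: MochizukiAbsTopIII2015, Definition 3.1 (iv) p.69] -/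
theorem iotaLogMap_unitsGal (σ : PadicAlgCl p ≃ₐ[ℚ_[p]] PadicAlgCl p) (u : TimesCarrier p) :
    iotaLogMap (unitsGal σ u) = unitsPfGal σ (iotaLogMap u) := by
  -- `log_k̄⁻¹(σ y) = σ · log_k̄⁻¹(y)` in `(𝒪^×_k̄)^pf`
  have hσx : (padicLog p).logEquiv.symm (Multiplicative.ofAdd (σ (u.toUnits : PadicAlgCl p))) =
      unitsModTorsionGaloisMap σ
        ((padicLog p).logEquiv.symm (Multiplicative.ofAdd (u.toUnits : PadicAlgCl p))) := by
    apply (padicLog p).logEquiv.injective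
    rw [MulEquiv.apply_symm_apply, (padicLog p).logEquiv_unitsModTorsionGaloisMap σ,
      MulEquiv.apply_symm_apply, toAdd_ofAdd]
  change unitsPfIncl ((padicLog p).logEquiv.symm (Multiplicative.ofAdd (σ (u.toUnits : PadicAlgCl p)))) =
    unitsPfGal σ (unitsPfIncl ((padicLog p).logEquiv.symm
      (Multiplicative.ofAdd (u.toUnits : PadicAlgCl p))))
  rw [hσx]
  -- both sides are `[σ v]` for `log_k̄⁻¹(y) = [v]`
  generalize (padicLog p).logEquiv.symm (Multiplicative.ofAdd (u.toUnits : PadicAlgCl p)) = x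
  induction x using QuotientGroup.induction_on with
  | H v => rfl

variable (p) in
/-- The unit `p ∈ k̄^×` (a non-unit of `𝒪_k̄`). [cite: MochizukiAbsTopIII2015, Lemma 3.4 p.74] -/
def primeTimes : TimesCarrier p :=
  TimesCarrier.ofUnits (Units.mk0 (p : PadicAlgCl p) (IwasawaLog.natCast_prime_ne_zero p))

/-- The value of `primeTimes` is `p`. [cite: MochizukiAbsTopIII2015, Lemma 3.4 p.74] -/
@[simp] theorem coe_primeTimes : ((primeTimes p).toUnits : PadicAlgCl p) = p := rfl

/-- A non-unit of `𝒪_k̄` is not in the image of `ι_log`: concretely `[p] ∉ ι_log(k̄^×)`, since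
`ι_log` lands in `(𝒪^×_k̄)^pf` and no power of `v · p⁻¹` (`v` a unit) is `1` (`‖p‖ < 1`) — the content
of Lemma 3.4 used by Cor 3.6 (iv) / 3.7 (iv): "`(𝒪^⊳_k̄)^pf ⊆ (𝒪^×_k̄)^pf`, a contradiction" (cf.
abc-iut-L4-t2's `pow_not_mem_unitSubmonoid_of_preserves`). [cite: MochizukiAbsTopIII2015, Lemma 3.4 p.74] -/
theorem iotaLogMap_ne_timesToPf_prime (u : TimesCarrier p) : iotaLogMap u ≠ timesToPf (primeTimes p) := by
  obtain ⟨v, hv, hvu⟩ := iotaLogMap_mem_range u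
  rw [hvu, Ne, timesToPf_eq_iff]
  rintro ⟨n, hn, hvn⟩
  rw [TimesCarrier.toUnits_ofUnits, coe_primeTimes] at hvn
  have hv1 : ‖(v : PadicAlgCl p)‖ = 1 := (PadicAlgCl.mem_unitSubmonoid_iff _).mp hv
  have hnorm : (‖(v : PadicAlgCl p)‖ / ‖(p : PadicAlgCl p)‖) ^ n = 1 := by
    rw [← norm_div, ← norm_pow, hvn, norm_one]
  rw [hv1, PadicAlgCl.norm_natCast_prime, one_div, inv_inv] at hnorm
  have hp1 : (1 : ℝ) < p := by exact_mod_cast hp.out.one_lt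
  exact absurd hnorm (ne_of_gt (one_lt_pow₀ hp1 hn.ne'))

end Literature.AnabelianGeometry.AbsoluteAnabelian.AbsTopIII

end
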